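import Summits.CriticalPhenomena.PercolationContinuityZ3.Theorems.PercNearOneGluingNoHeavyLowerTailAPLGluedCells
import HarnessLib

/-!
# `NoHeavyLowerTail` (stmt-CriticalPhenomena-4575) — the graph ↔ cells dictionary, 0: support bridge, total mass, nonnegativity and GZ (5.1) for the `PrW` cells

Support file (prover prim-ineq-gen-8 gen 36; `--supports stmt-CriticalPhenomena-4575`; memo
run/shared/lean/prim/prim-ineq-gen-8/FINDING-gen36-LEMMA-U.md §4–§5, step (D0)).  No definitions, no named facts, no sorries.

Cells of `(a; b, c)` on an edge set `D` with weights `p` as in `…APLGluedCells.lean` (`u0 = PrW D p {a|b|c}`, …).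
* `PrW_congr_weights`, `PrW_of_support` — `PrW D p` depends only on `p` on `D`, and enlarging `D` by coordinates of weight `0` does not change
  it (so the tree's theorems stated at `D = univ` apply to every edge set: put weight `0` off `D`).
* `cells_sum_eq_one`, `cells_nonneg` — the five cells are `≥ 0` and sum to `1` (`0 ≤ p ≤ 1`).
* `cells_iso`, `cells_conn`, `cells_isoDiffTri` — the events of `Gladkov.PrW_iso_mul_PrW_conn_le_sharp` in terms of the five cells.
* **`cells_gz`** — Gladkov–Zimin (5.1) for the cells of ANY edge set `D` (`0 ≤ p ≤ 1`), in the polynomial form consumed by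
  `conjF_union_all` / `region_union`: `0 ≤ (uab+uac+ubc)(u0+uab+uac+ubc+u3) − uab² − uac² − (u0+ubc)(uab+uac+u3)` — the tree theorem
  `Literature.Probability.Percolation.Gladkov.PrW_iso_mul_PrW_conn_le_sharp` (GZ24 (5.1)) transported through the support bridge.
[folklore; GZ (5.1) is cited in the tree theorem]
-/

namespace Summit.CriticalPhenomena.PercolationContinuityZ3.Theorems

namespace APL

open Literature.Probability.Percolation Literature.Probability.Percolation.Gladkov Literature.Probability.Percolation.DecisionTree
open scoped Classical

section Weights

variable {ι : Type*} [DecidableEq ι]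

/-- `PrW D p` depends only on the weights on `D`. [folklore] -/
theorem PrW_congr_weights (D : Finset ι) {p q : ι → ℝ} (h : ∀ i ∈ D, p i = q i) (X : Set (Finset ι)) :
    PrW D p X = PrW D q X := by
  have hw : ∀ S, wtW D p S = wtW D q S := fun S => by
    unfold wtW
    exact Finset.prod_congr rfl fun i hi => by rw [h i hi]
  unfold PrW
  refine Finset.sum_congr rfl fun S _ => ?_
  by_cases hS : S ∈ X
  · rw [Set.indicator_of_mem hS, Set.indicator_of_mem hS, hw]
  · rw [Set.indicator_of_notMem hS, Set.indicator_of_notMem hS]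

/-- A configuration containing a coordinate of weight `0` has weight `0`. [folklore] -/
theorem wtW_eq_zero_of_mem (D : Finset ι) {p : ι → ℝ} {S : Finset ι} {e : ι} (he : e ∈ S) (heD : e ∈ D) (hp : p e = 0) :
    wtW D p S = 0 := by
  unfold wtW
  exact Finset.prod_eq_zero heD (by rw [if_pos he, hp])

/-- **Support bridge**: enlarging the coordinate set by coordinates of weight `0` does not change `PrW`. [folklore] -/
theorem PrW_of_support (p : ι → ℝ) {D D' : Finset ι} (hsub : D ⊆ D') (hz : ∀ e ∈ D', e ∉ D → p e = 0) (X : Set (Finset ι)) :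
    PrW D' p X = PrW D p X := by
  have hD : D ∪ (D' \ D) = D' := Finset.union_sdiff_of_subset hsub
  rw [← hD, PrW_glue_sum p Finset.disjoint_sdiff X, PrW_eq_sum_ind]
  refine Finset.sum_congr rfl fun S₁ _ => ?_
  rw [Finset.sum_eq_single_of_mem ∅ (Finset.empty_mem_powerset _)]
  · have h1 : wtW (D' \ D) p ∅ = 1 := by
      unfold wtW
      exact Finset.prod_eq_one fun i hi => by
        rw [if_neg (Finset.notMem_empty i), hz i (Finset.mem_sdiff.1 hi).1 (Finset.mem_sdiff.1 hi).2, sub_zero]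
    rw [h1, Finset.union_empty, mul_one]
  · intro S₂ hS₂ hne
    obtain ⟨e, he⟩ := Finset.nonempty_iff_ne_empty.2 hne
    have heD : e ∈ D' \ D := Finset.mem_powerset.1 hS₂ he
    rw [wtW_eq_zero_of_mem (D' \ D) he heD (hz e (Finset.mem_sdiff.1 heD).1 (Finset.mem_sdiff.1 heD).2)]
    ring

end Weights

variable {V : Type*} [Fintype V] [DecidableEq V]

/-- **The five cells sum to one.** [folklore] -/
theorem cells_sum_eq_one (p : Sym2 V → ℝ) (D : Finset (Sym2 V)) (a b c : V) :
    PrW D p {K : Finset (Sym2 V) | b ∉ cl K a ∧ c ∉ cl K a ∧ c ∉ cl K b} + PrW D p {K : Finset (Sym2 V) | b ∈ cl K a ∧ c ∉ cl K a} + PrW D p {K : Finset (Sym2 V) | c ∈ cl K a ∧ b ∉ cl K a}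
      + PrW D p {K : Finset (Sym2 V) | b ∉ cl K a ∧ c ∉ cl K a ∧ c ∈ cl K b} + PrW D p {K : Finset (Sym2 V) | b ∈ cl K a ∧ c ∈ cl K a} = 1 := by
  rw [← sum_wtW D p]
  simp only [PrW_eq_sum_ind, ← Finset.sum_add_distrib]
  refine Finset.sum_congr rfl fun S _ => ?_
  rw [← mul_add, ← mul_add, ← mul_add, ← mul_add]
  conv_rhs => rw [← mul_one (wtW D p S)]
  congr 1
  rcases cl_cell_cases S a b c with ⟨h1, h2, h3⟩ | ⟨h1, h2, h3⟩ | ⟨h1, h2, h3⟩ | ⟨h1, h2, h3⟩ | ⟨h1, h2, h3⟩ <;>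
  simp [ind, Set.mem_setOf_eq, h1, h2, h3]

/-- The cells are nonnegative (`0 ≤ p ≤ 1`). [folklore] -/
theorem cells_nonneg {p : Sym2 V → ℝ} (hp0 : ∀ e, 0 ≤ p e) (hp1 : ∀ e, p e ≤ 1) (D : Finset (Sym2 V)) (a b c : V) :
    0 ≤ PrW D p {K : Finset (Sym2 V) | b ∉ cl K a ∧ c ∉ cl K a ∧ c ∉ cl K b} ∧ 0 ≤ PrW D p {K : Finset (Sym2 V) | b ∈ cl K a ∧ c ∉ cl K a} ∧ 0 ≤ PrW D p {K : Finset (Sym2 V) | c ∈ cl K a ∧ b ∉ cl K a}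
      ∧ 0 ≤ PrW D p {K : Finset (Sym2 V) | b ∉ cl K a ∧ c ∉ cl K a ∧ c ∈ cl K b} ∧ 0 ≤ PrW D p {K : Finset (Sym2 V) | b ∈ cl K a ∧ c ∈ cl K a} :=
  ⟨PrW_nonneg D hp0 hp1 _, PrW_nonneg D hp0 hp1 _, PrW_nonneg D hp0 hp1 _, PrW_nonneg D hp0 hp1 _, PrW_nonneg D hp0 hp1 _⟩

/-- `P(a ↮ b, a ↮ c) = u0 + ubc`. [folklore] -/
theorem cells_iso (p : Sym2 V → ℝ) (D : Finset (Sym2 V)) (a b c : V) :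
    PrW D p (iso a b c) = PrW D p {K : Finset (Sym2 V) | b ∉ cl K a ∧ c ∉ cl K a ∧ c ∉ cl K b} + PrW D p {K : Finset (Sym2 V) | b ∉ cl K a ∧ c ∉ cl K a ∧ c ∈ cl K b} := by
  simp only [PrW_eq_sum_ind, ← Finset.sum_add_distrib]
  refine Finset.sum_congr rfl fun S _ => ?_
  rw [← mul_add]
  congr 1
  rcases cl_cell_cases S a b c with ⟨h1, h2, h3⟩ | ⟨h1, h2, h3⟩ | ⟨h1, h2, h3⟩ | ⟨h1, h2, h3⟩ | ⟨h1, h2, h3⟩ <;>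
  simp [ind, iso, Set.mem_setOf_eq, h1, h2, h3]

/-- `P(a ↔ b ∪ a ↔ c) = uab + uac + u3`. [folklore] -/
theorem cells_conn (p : Sym2 V → ℝ) (D : Finset (Sym2 V)) (a b c : V) :
    PrW D p (conn a b ∪ conn a c) = PrW D p {K : Finset (Sym2 V) | b ∈ cl K a ∧ c ∉ cl K a} + PrW D p {K : Finset (Sym2 V) | c ∈ cl K a ∧ b ∉ cl K a} + PrW D p {K : Finset (Sym2 V) | b ∈ cl K a ∧ c ∈ cl K a} := by
  simp only [PrW_eq_sum_ind, ← Finset.sum_add_distrib]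
  refine Finset.sum_congr rfl fun S _ => ?_
  rw [← mul_add, ← mul_add]
  congr 1
  rcases cl_cell_cases S a b c with ⟨h1, h2, h3⟩ | ⟨h1, h2, h3⟩ | ⟨h1, h2, h3⟩ | ⟨h1, h2, h3⟩ | ⟨h1, h2, h3⟩ <;>
  simp [ind, Set.mem_union, mem_conn_iff_mem_cl, Set.mem_setOf_eq, h1, h2]

/-- `P(a ↮ b, a ↮ c, b ↔ c) = ubc` (the event `iso ∖ tri` of the tree theorem). [folklore] -/
theorem cells_isoDiffTri (p : Sym2 V → ℝ) (D : Finset (Sym2 V)) (a b c : V) :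
    PrW D p (iso a b c \ tri a b c) = PrW D p {K : Finset (Sym2 V) | b ∉ cl K a ∧ c ∉ cl K a ∧ c ∈ cl K b} := by
  refine PrW_congr_set D p fun S _ => ?_
  simp only [iso, tri, Set.mem_sdiff, Set.mem_setOf_eq, not_and, not_not]
  constructor
  · rintro ⟨⟨h1, h2⟩, h3⟩
    exact ⟨h1, h2, mem_cl_comm.1 (h3 h1 h2)⟩
  · rintro ⟨h1, h2, h3⟩
    exact ⟨⟨h1, h2⟩, fun _ _ => mem_cl_comm.1 h3⟩

/-- **Gladkov–Zimin (5.1) for the cells of an arbitrary edge set** (`0 ≤ p ≤ 1`), in the polynomial form of `conjF_union_all`: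
`0 ≤ (uab+uac+ubc)·S − uab² − uac² − (u0+ubc)·(uab+uac+u3)` (`S` = the sum of the cells `= 1`).  The tree theorem
`Gladkov.PrW_iso_mul_PrW_conn_le_sharp` at `D = univ` with weight `0` off `D`, transported by `PrW_of_support`.
[cite: GladkovZimin2024, §5 inequality (5.1), arXiv:2404.08873] -/
theorem cells_gz {p : Sym2 V → ℝ} (hp0 : ∀ e, 0 ≤ p e) (hp1 : ∀ e, p e ≤ 1) (D : Finset (Sym2 V)) (a b c : V) :
    0 ≤ (PrW D p {K : Finset (Sym2 V) | b ∈ cl K a ∧ c ∉ cl K a} + PrW D p {K : Finset (Sym2 V) | c ∈ cl K a ∧ b ∉ cl K a} + PrW D p {K : Finset (Sym2 V) | b ∉ cl K a ∧ c ∉ cl K a ∧ c ∈ cl K b})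
        * (PrW D p {K : Finset (Sym2 V) | b ∉ cl K a ∧ c ∉ cl K a ∧ c ∉ cl K b} + PrW D p {K : Finset (Sym2 V) | b ∈ cl K a ∧ c ∉ cl K a} + PrW D p {K : Finset (Sym2 V) | c ∈ cl K a ∧ b ∉ cl K a} + PrW D p {K : Finset (Sym2 V) | b ∉ cl K a ∧ c ∉ cl K a ∧ c ∈ cl K b} + PrW D p {K : Finset (Sym2 V) | b ∈ cl K a ∧ c ∈ cl K a})
      - PrW D p {K : Finset (Sym2 V) | b ∈ cl K a ∧ c ∉ cl K a} ^ 2 - PrW D p {K : Finset (Sym2 V) | c ∈ cl K a ∧ b ∉ cl K a} ^ 2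
      - (PrW D p {K : Finset (Sym2 V) | b ∉ cl K a ∧ c ∉ cl K a ∧ c ∉ cl K b} + PrW D p {K : Finset (Sym2 V) | b ∉ cl K a ∧ c ∉ cl K a ∧ c ∈ cl K b}) * (PrW D p {K : Finset (Sym2 V) | b ∈ cl K a ∧ c ∉ cl K a} + PrW D p {K : Finset (Sym2 V) | c ∈ cl K a ∧ b ∉ cl K a} + PrW D p {K : Finset (Sym2 V) | b ∈ cl K a ∧ c ∈ cl K a}) := by
  -- weights supported on `D`
  set q : Sym2 V → ℝ := fun e => if e ∈ D then p e else 0 with hq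
  have hq0 : ∀ e, 0 ≤ q e := fun e => by rw [hq]; dsimp only; split_ifs <;> simp [hp0 e]
  have hq1 : ∀ e, q e ≤ 1 := fun e => by rw [hq]; dsimp only; split_ifs <;> simp [hp1 e]
  have hqp : ∀ e ∈ D, q e = p e := fun e he => by rw [hq]; dsimp only; rw [if_pos he]
  have hz : ∀ e ∈ (Finset.univ : Finset (Sym2 V)), e ∉ D → q e = 0 := fun e _ he => by rw [hq]; dsimp only; rw [if_neg he]
  have bridge : ∀ X : Set (Finset (Sym2 V)), PrW Finset.univ q X = PrW D p X := fun X => by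
    rw [PrW_of_support q (Finset.subset_univ D) hz X, PrW_congr_weights D hqp X]
  have key := PrW_iso_mul_PrW_conn_le_sharp hq0 hq1 a b c
  rw [bridge, bridge, bridge, bridge, bridge, cells_iso, cells_conn, cells_isoDiffTri] at key
  have hs := cells_sum_eq_one p D a b c
  rw [hs, mul_one]
  nlinarith [key]

end APL

end Summit.CriticalPhenomena.PercolationContinuityZ3.Theorems
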